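import Mathlib
import Summits.ResolutionOfSingularities.ResolutionOfSingularities.Theorems.HomologicalConductorPersistenceKC3UpperLocal
import Literature.AlgebraicGeometry.Resolution.BlowupChartPair
import HarnessLib

/-!
# Crux `Persistence` (stmt-ResolutionOfSingularities-16484) — w44b K-C3, K2c (c0): the affine coordinate ring of the
# K-C3 datum is `k[x,y,z,t]/(xy − z³ − t⁴)` — `ker (k[X₀,…,X₃] → K, X ↦ (x, (z³+t⁴)x⁻¹, z, t)) = (X 0 * X 1 − X 2³ − X 3⁴)`

Route `ResolutionOfSingularities/HomologicalConductor`, chain W4.4b (cell `res-hironaka`), crux `Persistence`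
(stmt-ResolutionOfSingularities-16484), KILL CANDIDATE K-C3, KC3 SPELLING v1.1 (res-L1-w44b-plan-1 2026-08-27T11:44:56Z /
12:00:59Z): `K` a fraction field of `k[x,z,t] = MvPolynomial (Fin 3) k`, `x, z, t` the images of `X 0, X 1, X 2`,
`A = k[x, z, t, (z³+t⁴)·x⁻¹] ⊆ K`. This file identifies the RELATIONS of `A`: the kernel of the evaluation
`φ₀ : k[X₀, X₁, X₂, X₃] → K`, `X ↦ (x, (z³+t⁴)x⁻¹, z, t)` is the principal ideal `(X 0 * X 1 − X 2 ^ 3 − X 3 ^ 4)` — the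
affine blow-up chart relation `x·Y = z³ + t⁴` (the tree's `BlowupChartPair.ker_chartEval_twistedPencil`, Stacks 0BIQ with
`p = 1`, `g₀ = z³ + t⁴` free of `x`, after the variable shuffle `k[X₀..X₃] ≃ k[x,z,t][Y]`, `X 1 ↦ Y`) — and that `A` is the
range of `φ₀`. res-type-010 (K2c (c0)+(c1) OFFER → TAKING-UNLESS-OBJECTED 12:17:48Z; plan-1 «K5 glue (010)»). OURS; nothing here is
a statement of the manuscript under review (Hironaka 2017); AI-written, weaker than expert review. Filed
`--supports stmt-ResolutionOfSingularities-16484 --as helper`.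

* `shuffle_f` — the shuffle `E = (swap X 0 X 1) ≫ finSuccEquiv` sends `X 0 * X 1 − X 2³ − X 3⁴` to `C x * Y − C (z³+t⁴)`;
* `awayToField_injective` — `k[x,z,t][1/x] → K` is injective;
* `aeval_kc3_eq_comp` — `φ₀ = (k[x,z,t][1/x] → K) ∘ chartEval x (z³+t⁴) ∘ E`;
* **`ker_aeval_kc3`** — `ker φ₀ = (X 0 * X 1 − X 2 ^ 3 − X 3 ^ 4)`; **`range_aeval_kc3`** — `range φ₀ = A`.

References: The Stacks Project, Tag 0BIQ [cite: StacksProject, Tag 0BIQ] (through `BlowupChartPair`).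
-/

noncomputable section

-- single-problem summit: the doubled namespace component `ResolutionOfSingularities` is forced
set_option linter.dupNamespace false

namespace Summit.ResolutionOfSingularities.ResolutionOfSingularities.Theorems.HomologicalConductor.KC3Upper

open MvPolynomial
open Literature.AlgebraicGeometry.Resolution

section Kernel

variable (k : Type) [Field k] (K : Type) [Field K] [Algebra (MvPolynomial (Fin 3) k) K]
  [IsFractionRing (MvPolynomial (Fin 3) k) K] [Algebra k K] [IsScalarTower k (MvPolynomial (Fin 3) k) K]

/-- The variable shuffle `E : k[X₀,X₁,X₂,X₃] ≃ k[x,z,t][Y]` (`X 1 ↦ Y`, `X 0 ↦ x = X 0`, `X 2 ↦ z = X 1`, `X 3 ↦ t = X 2`) sends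
`X 0 * X 1 − X 2 ^ 3 − X 3 ^ 4` to `C x * Y − C (z³ + t⁴)`. [folklore] -/
theorem shuffle_f :
    ((MvPolynomial.renameEquiv k (Equiv.swap (0 : Fin 4) 1)).trans (MvPolynomial.finSuccEquiv k 3))
        (X 0 * X 1 - X 2 ^ 3 - X 3 ^ 4 : MvPolynomial (Fin 4) k) =
      Polynomial.C (X 0 : MvPolynomial (Fin 3) k) * Polynomial.X -
        Polynomial.C (X 1 ^ 3 + X 2 ^ 4 : MvPolynomial (Fin 3) k) := by
  have h0 : (Equiv.swap (0 : Fin 4) 1) 0 = 1 := Equiv.swap_apply_left _ _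
  have h1 : (Equiv.swap (0 : Fin 4) 1) 1 = 0 := Equiv.swap_apply_right _ _
  have h2 : (Equiv.swap (0 : Fin 4) 1) 2 = 2 := by decide
  have h3 : (Equiv.swap (0 : Fin 4) 1) 3 = 3 := by decide
  have e1 : (1 : Fin 4) = Fin.succ 0 := rfl
  have e2 : (2 : Fin 4) = Fin.succ 1 := rfl
  have e3 : (3 : Fin 4) = Fin.succ 2 := rfl
  simp only [AlgEquiv.trans_apply, map_sub, map_mul, map_pow, MvPolynomial.renameEquiv_apply, MvPolynomial.rename_X,
    h0, h1, h2, h3]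
  rw [MvPolynomial.finSuccEquiv_X_zero, e1, e2, e3, MvPolynomial.finSuccEquiv_X_succ, MvPolynomial.finSuccEquiv_X_succ,
    MvPolynomial.finSuccEquiv_X_succ, map_add, map_pow, map_pow]
  ring

omit [Algebra k K] [IsScalarTower k (MvPolynomial (Fin 3) k) K] in
/-- `x = X 0 ≠ 0` maps to a non-zero element of the fraction field, so every power of `x` is a unit of `K`. [folklore] -/
theorem isUnit_algebraMap_powers (y : Submonoid.powers (X 0 : MvPolynomial (Fin 3) k)) :
    IsUnit (algebraMap (MvPolynomial (Fin 3) k) K y) := by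
  obtain ⟨n, hn⟩ := y.2
  rw [← hn, map_pow]
  exact (isUnit_iff_ne_zero.mpr
    ((map_ne_zero_iff _ (IsFractionRing.injective (MvPolynomial (Fin 3) k) K)).mpr (MvPolynomial.X_ne_zero 0))).pow n

omit [Algebra k K] [IsScalarTower k (MvPolynomial (Fin 3) k) K] in
/-- The canonical map `k[x,z,t][1/x] → K` is injective. [folklore] -/
theorem awayToField_injective :
    Function.Injective (IsLocalization.lift (M := Submonoid.powers (X 0 : MvPolynomial (Fin 3) k))
      (S := Localization.Away (X 0 : MvPolynomial (Fin 3) k)) (g := algebraMap (MvPolynomial (Fin 3) k) K)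
      (isUnit_algebraMap_powers k K)) := by
  rw [injective_iff_map_eq_zero]
  intro w hw
  obtain ⟨r, s, rfl⟩ := IsLocalization.exists_mk'_eq (Submonoid.powers (X 0 : MvPolynomial (Fin 3) k)) w
  rw [IsLocalization.lift_mk'_spec, mul_zero, map_eq_zero_iff _ (IsFractionRing.injective _ _)] at hw
  rw [hw, IsLocalization.mk'_zero]

/-- `φ₀ : X ↦ (x, (z³+t⁴)x⁻¹, z, t)` FACTORS as `(k[x,z,t][1/x] → K) ∘ chartEval x (z³+t⁴) ∘ E` (ring maps). [folklore] -/
theorem aeval_kc3_eq_comp :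
    (MvPolynomial.aeval (R := k)
        (![algebraMap (MvPolynomial (Fin 3) k) K (X 0),
          (algebraMap (MvPolynomial (Fin 3) k) K (X 1) ^ 3 + algebraMap (MvPolynomial (Fin 3) k) K (X 2) ^ 4) *
            (algebraMap (MvPolynomial (Fin 3) k) K (X 0))⁻¹,
          algebraMap (MvPolynomial (Fin 3) k) K (X 1), algebraMap (MvPolynomial (Fin 3) k) K (X 2)] :
          Fin 4 → K)).toRingHom =
      (IsLocalization.lift (M := Submonoid.powers (X 0 : MvPolynomial (Fin 3) k))
          (S := Localization.Away (X 0 : MvPolynomial (Fin 3) k)) (g := algebraMap (MvPolynomial (Fin 3) k) K)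
          (isUnit_algebraMap_powers k K)).comp
        ((BlowupChartPair.chartEval (X 0 : MvPolynomial (Fin 3) k) (X 1 ^ 3 + X 2 ^ 4)).toRingHom.comp
          ((MvPolynomial.renameEquiv k (Equiv.swap (0 : Fin 4) 1)).trans
            (MvPolynomial.finSuccEquiv k 3)).toRingEquiv.toRingHom) := by
  have hx0 : algebraMap (MvPolynomial (Fin 3) k) K (X 0) ≠ 0 :=
    (map_ne_zero_iff _ (IsFractionRing.injective (MvPolynomial (Fin 3) k) K)).mpr (MvPolynomial.X_ne_zero 0)
  -- the value of `Y`
  have hY : IsLocalization.lift (M := Submonoid.powers (X 0 : MvPolynomial (Fin 3) k))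
        (S := Localization.Away (X 0 : MvPolynomial (Fin 3) k)) (g := algebraMap (MvPolynomial (Fin 3) k) K)
        (isUnit_algebraMap_powers k K)
        (IsLocalization.mk' (Localization.Away (X 0 : MvPolynomial (Fin 3) k)) (X 1 ^ 3 + X 2 ^ 4)
          (⟨X 0, Submonoid.mem_powers _⟩ : Submonoid.powers (X 0 : MvPolynomial (Fin 3) k))) =
      (algebraMap (MvPolynomial (Fin 3) k) K (X 1) ^ 3 + algebraMap (MvPolynomial (Fin 3) k) K (X 2) ^ 4) *
        (algebraMap (MvPolynomial (Fin 3) k) K (X 0))⁻¹ := by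
    rw [IsLocalization.lift_mk'_spec]
    simp only [map_add, map_pow]
    field_simp
  have h0 : (Equiv.swap (0 : Fin 4) 1) 0 = 1 := Equiv.swap_apply_left _ _
  have h1 : (Equiv.swap (0 : Fin 4) 1) 1 = 0 := Equiv.swap_apply_right _ _
  have h2 : (Equiv.swap (0 : Fin 4) 1) 2 = 2 := by decide
  have h3 : (Equiv.swap (0 : Fin 4) 1) 3 = 3 := by decide
  have e1 : (1 : Fin 4) = Fin.succ 0 := rfl
  have e2 : (2 : Fin 4) = Fin.succ 1 := rfl
  have e3 : (3 : Fin 4) = Fin.succ 2 := rfl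
  refine MvPolynomial.ringHom_ext (fun c => ?_) (fun i => ?_)
  · -- constants
    simp only [AlgHom.toRingHom_eq_coe, RingHom.coe_coe, MvPolynomial.algHom_C, RingHom.comp_apply,
      RingEquiv.toRingHom_eq_coe, RingHom.coe_coe, AlgEquiv.coe_ringEquiv,
      AlgEquiv.trans_apply, MvPolynomial.renameEquiv_apply]
    rw [MvPolynomial.algebraMap_eq, MvPolynomial.finSuccEquiv_apply, MvPolynomial.eval₂Hom_C, RingHom.comp_apply,
      BlowupChartPair.chartEval_C, IsLocalization.lift_eq, IsScalarTower.algebraMap_apply k (MvPolynomial (Fin 3) k) K c,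
      MvPolynomial.algebraMap_eq]
  · fin_cases i
    · simp only [AlgHom.toRingHom_eq_coe, RingHom.coe_coe, MvPolynomial.aeval_X, RingHom.comp_apply,
        RingEquiv.toRingHom_eq_coe, AlgEquiv.coe_ringEquiv, AlgEquiv.trans_apply,
        MvPolynomial.renameEquiv_apply, MvPolynomial.rename_X, Fin.zero_eta, Matrix.cons_val_zero, h0]
      rw [e1, MvPolynomial.finSuccEquiv_X_succ, BlowupChartPair.chartEval_C, IsLocalization.lift_eq]
    · simp only [AlgHom.toRingHom_eq_coe, RingHom.coe_coe, MvPolynomial.aeval_X, RingHom.comp_apply,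
        RingEquiv.toRingHom_eq_coe, AlgEquiv.coe_ringEquiv, AlgEquiv.trans_apply,
        MvPolynomial.renameEquiv_apply, MvPolynomial.rename_X, Fin.mk_one, Matrix.cons_val_one, Matrix.cons_val_zero, h1]
      rw [MvPolynomial.finSuccEquiv_X_zero, BlowupChartPair.chartEval, Polynomial.aeval_X, hY]
    · simp only [AlgHom.toRingHom_eq_coe, RingHom.coe_coe, MvPolynomial.aeval_X, RingHom.comp_apply,
        RingEquiv.toRingHom_eq_coe, AlgEquiv.coe_ringEquiv, AlgEquiv.trans_apply,
        MvPolynomial.renameEquiv_apply, MvPolynomial.rename_X, Fin.reduceFinMk, Matrix.cons_val, h2]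
      rw [e2, MvPolynomial.finSuccEquiv_X_succ, BlowupChartPair.chartEval_C, IsLocalization.lift_eq]
    · simp only [AlgHom.toRingHom_eq_coe, RingHom.coe_coe, MvPolynomial.aeval_X, RingHom.comp_apply,
        RingEquiv.toRingHom_eq_coe, AlgEquiv.coe_ringEquiv, AlgEquiv.trans_apply,
        MvPolynomial.renameEquiv_apply, MvPolynomial.rename_X, Fin.reduceFinMk, Matrix.cons_val, h3]
      rw [e3, MvPolynomial.finSuccEquiv_X_succ, BlowupChartPair.chartEval_C, IsLocalization.lift_eq]

/-- **K2c (c0) (OURS · w44b): the relations of the K-C3 coordinate ring.** For every field `k` and every fraction field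
`K` of `k[x,z,t]`: `ker (φ₀ : k[X₀,…,X₃] → K, X ↦ (x, (z³+t⁴)x⁻¹, z, t)) = (X 0 * X 1 − X 2 ^ 3 − X 3 ^ 4)` — the K-C3
subalgebra `A = k[x, z, t, (z³+t⁴)/x]` IS the affine hypersurface `xy = z³ + t⁴` of the K-C3 kernel files (U12 convention
`x, y, z, t = X 0..3`). Stacks 0BIQ (`BlowupChartPair.ker_chartEval_twistedPencil`, `p = 1`) after the shuffle.
[cite: StacksProject, Tag 0BIQ] -/
theorem ker_aeval_kc3 :
    RingHom.ker (MvPolynomial.aeval (R := k)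
        (![algebraMap (MvPolynomial (Fin 3) k) K (X 0),
          (algebraMap (MvPolynomial (Fin 3) k) K (X 1) ^ 3 + algebraMap (MvPolynomial (Fin 3) k) K (X 2) ^ 4) *
            (algebraMap (MvPolynomial (Fin 3) k) K (X 0))⁻¹,
          algebraMap (MvPolynomial (Fin 3) k) K (X 1), algebraMap (MvPolynomial (Fin 3) k) K (X 2)] :
          Fin 4 → K)).toRingHom =
      Ideal.span {(X 0 * X 1 - X 2 ^ 3 - X 3 ^ 4 : MvPolynomial (Fin 4) k)} := by
  -- the Stacks 0BIQ kernel for the pair `(x, z³ + t⁴)`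
  have hker := BlowupChartPair.ker_chartEval_twistedPencil k 2 1 (X 0 ^ 3 + X 1 ^ 4 : MvPolynomial (Fin 2) k) ?_
    (X 0 : MvPolynomial (Fin 3) k) (X 1 ^ 3 + X 2 ^ 4) ?_ ?_
  rotate_left
  · intro h
    have := congrArg (MvPolynomial.eval (![1, 0] : Fin 2 → k)) h
    simp at this
  · rw [pow_one, MvPolynomial.finSuccEquiv_X_zero]
  · have e1 : (1 : Fin 3) = Fin.succ 0 := rfl
    have e2 : (2 : Fin 3) = Fin.succ 1 := rfl
    rw [map_add, map_pow, map_pow, e1, e2, MvPolynomial.finSuccEquiv_X_succ, MvPolynomial.finSuccEquiv_X_succ, ← map_pow,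
      ← map_pow, ← map_add]
  rw [aeval_kc3_eq_comp, ← RingHom.comap_ker, (RingHom.injective_iff_ker_eq_bot _).mp (awayToField_injective k K),
    ← RingHom.ker_eq_comap_bot, ← RingHom.comap_ker, hker]
  -- `E⁻¹ (C x * Y − C (z³+t⁴)) = f₀`
  set E := ((MvPolynomial.renameEquiv k (Equiv.swap (0 : Fin 4) 1)).trans (MvPolynomial.finSuccEquiv k 3)) with hE
  rw [RingEquiv.toRingHom_eq_coe, Ideal.comap_coe, ← Ideal.map_symm, Ideal.map_span, Set.image_singleton]
  congr 2
  rw [RingEquiv.symm_apply_eq]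
  exact (shuffle_f k).symm

omit [IsScalarTower k (MvPolynomial (Fin 3) k) K] in
/-- **`range φ₀ = A`**: the K-C3 subalgebra `A = Algebra.adjoin k {x, z, t, (z³+t⁴)·x⁻¹}` (KC3 SPELLING v1.1) is the range
of `φ₀ : X ↦ (x, (z³+t⁴)x⁻¹, z, t)`. [folklore] -/
theorem range_aeval_kc3 :
    (MvPolynomial.aeval (R := k)
        (![algebraMap (MvPolynomial (Fin 3) k) K (X 0),
          (algebraMap (MvPolynomial (Fin 3) k) K (X 1) ^ 3 + algebraMap (MvPolynomial (Fin 3) k) K (X 2) ^ 4) *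
            (algebraMap (MvPolynomial (Fin 3) k) K (X 0))⁻¹,
          algebraMap (MvPolynomial (Fin 3) k) K (X 1), algebraMap (MvPolynomial (Fin 3) k) K (X 2)] :
          Fin 4 → K)).range =
      Algebra.adjoin k ({algebraMap (MvPolynomial (Fin 3) k) K (X 0), algebraMap (MvPolynomial (Fin 3) k) K (X 1),
        algebraMap (MvPolynomial (Fin 3) k) K (X 2),
        (algebraMap (MvPolynomial (Fin 3) k) K (X 1) ^ 3 + algebraMap (MvPolynomial (Fin 3) k) K (X 2) ^ 4) *
          (algebraMap (MvPolynomial (Fin 3) k) K (X 0))⁻¹} : Set K) := by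
  rw [← Algebra.adjoin_range_eq_range_aeval]
  congr 1
  ext w
  simp only [Set.mem_range, Set.mem_insert_iff, Set.mem_singleton_iff]
  constructor
  · rintro ⟨i, rfl⟩
    fin_cases i <;> simp
  · rintro (rfl | rfl | rfl | rfl)
    · exact ⟨0, by simp⟩
    · exact ⟨2, by simp⟩
    · exact ⟨3, by simp⟩
    · exact ⟨1, by simp⟩

/-- **`A ∩ ker`-form: `φ₀ p = 0 ↔ (X 0 * X 1 − X 2 ^ 3 − X 3 ^ 4) ∣ p`.** [folklore] -/
theorem aeval_kc3_eq_zero_iff (p : MvPolynomial (Fin 4) k) :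
    MvPolynomial.aeval (R := k)
        (![algebraMap (MvPolynomial (Fin 3) k) K (X 0),
          (algebraMap (MvPolynomial (Fin 3) k) K (X 1) ^ 3 + algebraMap (MvPolynomial (Fin 3) k) K (X 2) ^ 4) *
            (algebraMap (MvPolynomial (Fin 3) k) K (X 0))⁻¹,
          algebraMap (MvPolynomial (Fin 3) k) K (X 1), algebraMap (MvPolynomial (Fin 3) k) K (X 2)] :
          Fin 4 → K) p = 0 ↔
      (X 0 * X 1 - X 2 ^ 3 - X 3 ^ 4 : MvPolynomial (Fin 4) k) ∣ p := by
  rw [← Ideal.mem_span_singleton, ← ker_aeval_kc3 k K, RingHom.mem_ker, AlgHom.toRingHom_eq_coe, RingHom.coe_coe]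

end Kernel

end Summit.ResolutionOfSingularities.ResolutionOfSingularities.Theorems.HomologicalConductor.KC3Upper

end
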